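/-
Width seat `ym-line-cbag-p1-w3` (prover-ym-line-cbag-p1-w3-g8-0; own items stmt-QuantumFields-22254 `BoxFloorAllGroups` /
stmt-QuantumFields-22893 `ExpChartPackage2` CLOSED proved), helping LINE 3 `route-QuantumFields-SixPlaneColdBox`
(crux stmt-QuantumFields-25709 `DensityTransferG`): deep kernel MEANS under crude-good data are position-smooth along `e₀` IN EVERY PLANE
(the all-planes form of L1b-G `GoodBoundaryMeanSmoothG`, which is typed for the `(1,2)`-plaquette), for any separation exponent `0 < A < θ`.
-/
import Summits.QuantumFields.YangMills.Theorems.ColdBoxAllGroupsBulkAllGroupsMeanSmoothGExplicit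
import Summits.QuantumFields.YangMills.Theorems.SixPlaneColdBoxFlatBoxMeanG

/-!
# LINE 3 `SixPlaneColdBox`, glue: position-smoothness of deep kernel means in every plane (L1b-G for all six planes)

In the DLR transfer of crux `DensityTransferG` the conditional-mean covariance term `Cov_torus(E_ω F, E_ω F')` of the six-plane sums
`F = Σ_{i<j} c_{(c_H;i,j)}`, `F' = Σ_{i<j} c_{(c_H+Te₀;i,j)}` is handled, as in `BulkAllGroups`, by `Cov(h,k) ≥ −¼∫(k−h)²` and the smallness of
`k − h = Σ_{i<j} (E_ω c_{(c_H+Te₀;i,j)} − E_ω c_{(c_H;i,j)})` — i.e. by L1b-G `GoodBoundaryMeanSmoothG` in EACH of the six planes.  The tree's L1b-G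
(`goodBoundaryMeanSmoothG_at`, `goodBoundaryMeanSmoothG_allGroups`) is typed for the `(1,2)`-plaquette and the separation exponent `A = θ/20`;
its proof (telescoped interior gradient bounds of the harmonic background `dirBackground_interior_bounds` — all planes —, the flat Dirichlet
variance, the two expansion errors) is plane-generic.  With the all-planes mean expansion «KernelMeanSharpG» and the all-planes flatness of the
Dirichlet variance (`abs_boxDirProjKernel_diag_sub_le`) this file records:

* `goodBoundaryMeanSmoothG_plane_at` — the body of `goodBoundaryMeanSmoothG_at` for a general plane `(i,j)` and a general separation exponent
  `0 < A < θ`: the plane-`(i,j)` mean expansion (error `β^{−θ}`) and the plane-`(i,j)` flat variance give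
  `|E_ω c_{(c_H+⌈β^A⌉e₀;i,j)} − E_ω c_{(c_H;i,j)}| ≤ K·β^{2δ−1}·⌈β^A⌉/⌈β^θ⌉` (`δ = θ/5`) for all crude-good `ω`, eventually in `β`;
* `dirKernelDiagFlat_plane` — the flat Dirichlet variance in plane `(i,j)` (rate `K/H`, integer near-centre form), from
  `abs_boxDirProjKernel_diag_sub_le`;
* `kernelMeanExpansion_plane_of_sharp` — the plane-`(i,j)` mean expansion with error `β^{−θ}` from `kernelMeanSharpG` (`β^{−1/4} ≤ β^{−θ}`);
* **`goodBoundaryMeanSmoothG_allPlanes`** — every compact simple `G`, every `r : LatticeRep G`, `0 < A < θ ≤ 1/200`, every plane `i < j`: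
  `∃ K β₀, ∀ β ≥ β₀, ∀ ω` crude-good (scale `β^{2(θ/5)−1}`): `|E_ω c_{(c_H+⌈β^A⌉e₀;i,j)} − E_ω c_{(c_H;i,j)}| ≤ K·β^{2(θ/5)−1}·⌈β^A⌉/⌈β^θ⌉`.

No sorry; no new definition; standard axioms.  NOT a claim about the Yang–Mills mass gap: glue for a LINE onto the RECORD-type node
`LatticeNonFreezing`; no summit statement is touched.
-/

set_option autoImplicit false

noncomputable section

open MeasureTheory ProbabilityTheory Finset Real Filter Topology Metric Matrix
open Literature.Probability.LatticeModels
open Literature.MathematicalPhysics.QuantumLattice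
open Literature.MathematicalPhysics.QuantumFieldTheory
open Literature.MathematicalPhysics.QuantumFieldTheory.LatticeMaxwell
open Literature.MathematicalPhysics.QuantumFieldTheory.AxialGauge
open Literature.MathematicalPhysics.QuantumFieldTheory.LatticeChain
open Literature.MathematicalPhysics.QuantumFieldTheory.LatticeForm (e d₁ d₁_swap)
open Summit.QuantumFields.YangMills.Theorems.WeakCouplingRates
open Summit.QuantumFields.YangMills.Theorems.FreeEnergyLogCoefficient (dimE)

namespace Summit.QuantumFields.YangMills.Theorems.ColdBoxAllGroups

section MeanSmooth

variable {N : ℕ} {G : Type*} [Group G] [TopologicalSpace G] [IsTopologicalGroup G] [CompactSpace G]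
  [MeasurableSpace G] [BorelSpace G]
variable (ρ : G →* Matrix (Fin N) (Fin N) ℂ)

/-- **L1b-G in a general plane `(i,j)` and for a general separation exponent `0 < A < θ`** (any `ρ`, any `θ > 0`): the plane-`(i,j)` one-scale
kernel mean expansion with error `β^{−θ}` and the plane-`(i,j)` flat Dirichlet variance (rate `K/H`) give: deep conditional means under
crude-good data are position-smooth, `|E_ω c_{(c_H+Te₀;i,j)} − E_ω c_{(c_H;i,j)}| ≤ K β^{2δ−1} T/H`, `T = ⌈β^A⌉`, `H = ⌈β^θ⌉`, `δ = θ/5`.  (Body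
of `goodBoundaryMeanSmoothG_at` verbatim with `(1,2) ↦ (i,j)`, `θ/20 ↦ A`.) -/
theorem goodBoundaryMeanSmoothG_plane_at {θ A : ℝ} (hθ : 0 < θ) (hA0 : 0 < A) (hAlt : A < θ) {i j : Fin 4}
    (hexp : ∃ CE : ℝ, ∃ β₀ : ℝ, ∀ β : ℝ, β₀ ≤ β → ∀ ω : LGConfig 4 G, CrudeGoodG ρ β (θ / 5) ⌈β ^ θ⌉₊ ω →
      ∃ ϑ : Fin (dimE ρ) → (Literature.MathematicalPhysics.QuantumLattice.ZdEdge 4 → ℝ), ∃ s : Fin (dimE ρ) → (DirFree ⌈β ^ θ⌉₊ → ℝ),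
        (∑ c, LatticeMaxwell.formM (fun e => e ∉ dirFreeEdges ⌈β ^ θ⌉₊) dirCorner (2 * ⌈β ^ θ⌉₊ + 3) (ϑ c) (s c) ≤
            CE * (2 * (⌈β ^ θ⌉₊ : ℝ) + 3) ^ 4 * β ^ (2 * (θ / 5) - 1)) ∧
        ∀ x : Site 4, (∀ m : Fin 4, 8 * |x m - (⌈β ^ θ⌉₊ : ℤ)| ≤ (⌈β ^ θ⌉₊ : ℤ)) →
          |β * (∫ U, plaqCostAt ρ x i j U ∂(boxKernelG ρ β ⌈β ^ θ⌉₊ ω)) -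
              (dimE ρ : ℝ) / 2 * boxDirProjKernel ⌈β ^ θ⌉₊ (x, i, j) (x, i, j) -
              β * ∑ c, LatticeMaxwell.sCirc (LatticeMaxwell.glue (pin := fun e => e ∉ dirFreeEdges ⌈β ^ θ⌉₊) dirCorner
                (2 * ⌈β ^ θ⌉₊ + 3) (ϑ c) (LatticeMaxwell.mean (fun e => e ∉ dirFreeEdges ⌈β ^ θ⌉₊) dirCorner (2 * ⌈β ^ θ⌉₊ + 3)
                (ϑ c))) (x, i, j) ^ 2| ≤ β ^ (-θ))
    (hflat : ∃ K : ℝ, ∃ H₀ : ℕ, ∀ H : ℕ, H₀ ≤ H → ∀ x x' : Site 4,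
      (∀ m : Fin 4, 8 * |x m - (H : ℤ)| ≤ (H : ℤ)) → (∀ m : Fin 4, 8 * |x' m - (H : ℤ)| ≤ (H : ℤ)) →
        |boxDirProjKernel H (x, i, j) (x, i, j) - boxDirProjKernel H (x', i, j) (x', i, j)| ≤ K / H) :
    ∃ K : ℝ, ∃ β₀ : ℝ, ∀ β : ℝ, β₀ ≤ β → ∀ ω : LGConfig 4 G, CrudeGoodG ρ β (θ / 5) ⌈β ^ θ⌉₊ ω →
      |(∫ U, plaqCostAt ρ (boxCentre ⌈β ^ θ⌉₊ + Pi.single 0 (⌈β ^ A⌉₊ : ℤ)) i j U ∂(boxKernelG ρ β ⌈β ^ θ⌉₊ ω)) -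
          (∫ U, plaqCostAt ρ (boxCentre ⌈β ^ θ⌉₊) i j U ∂(boxKernelG ρ β ⌈β ^ θ⌉₊ ω))|
        ≤ K * β ^ (2 * (θ / 5) - 1) * (⌈β ^ A⌉₊ : ℝ) / (⌈β ^ θ⌉₊ : ℝ) := by
  obtain ⟨KN, H₀, hN⟩ := hflat
  obtain ⟨C, hC0, hI⟩ := dirBackground_interior_bounds
  obtain ⟨CE, β₁, hE⟩ := hexp
  set δ : ℝ := θ / 5 with hδ
  have hAθ : 0 < θ - A := by linarith
  -- thresholds: β ≥ β₁, β ≥ 1, β^θ ≥ max H₀ 8, β^{θ−A} ≥ 16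
  set N₀ : ℝ := max (H₀ : ℝ) 8 with hN₀
  refine ⟨4 + (dimE ρ : ℝ) / 2 * |KN| + 1250 * |CE| * C ^ 2,
    max (max β₁ 1) (max (N₀ ^ (1 / θ)) ((16 : ℝ) ^ (1 / (θ - A)))), fun β hβ ω hω => ?_⟩
  have hβ₁ : β₁ ≤ β := le_trans (le_trans (le_max_left _ _) (le_max_left _ _)) hβ
  have hβ1 : (1 : ℝ) ≤ β := le_trans (le_trans (le_max_right _ _) (le_max_left _ _)) hβ
  have hβ0 : 0 < β := by linarith
  have hN₀β : N₀ ≤ β ^ θ :=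
    le_rpow_of_root_le (by rw [hN₀]; positivity) hθ (le_trans (le_trans (le_max_left _ _) (le_max_right _ _)) hβ)
  have h16 : (16 : ℝ) ≤ β ^ (θ - A) :=
    le_rpow_of_root_le (by norm_num) hAθ (le_trans (le_trans (le_max_right _ _) (le_max_right _ _)) hβ)
  set H : ℕ := ⌈β ^ θ⌉₊ with hHdef
  set T : ℕ := ⌈β ^ A⌉₊ with hTdef
  obtain ⟨hT1, hT2⟩ := one_le_ceil_rpow_and_le hβ1 hA0.le
  obtain ⟨hH1, hH2⟩ := one_le_ceil_rpow_and_le hβ1 hθ.le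
  rw [← hTdef] at hT1 hT2
  rw [← hHdef] at hH1 hH2
  have hHceil : β ^ θ ≤ (H : ℝ) := Nat.le_ceil _
  have hH8 : 8 ≤ H := by
    have : (8 : ℝ) ≤ H := le_trans (le_trans (le_max_right _ _) hN₀β) hHceil
    exact_mod_cast this
  have hHH₀ : H₀ ≤ H := by
    have : (H₀ : ℝ) ≤ H := le_trans (le_trans (le_max_left _ _) hN₀β) hHceil
    exact_mod_cast this
  have hHpos : (0 : ℝ) < H := by linarith
  have hH1' : (1 : ℝ) ≤ H := hH1
  -- `8T ≤ H`
  have h8T : 8 * T ≤ H := by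
    have h1 : (8 : ℝ) * T ≤ 16 * β ^ A := by linarith
    have h2 : (16 : ℝ) * β ^ A ≤ β ^ θ := by
      have : β ^ θ = β ^ (θ - A) * β ^ A := by
        rw [← Real.rpow_add hβ0]; ring_nf
      rw [this]
      exact mul_le_mul_of_nonneg_right h16 (Real.rpow_nonneg hβ0.le _)
    have : (8 : ℝ) * T ≤ H := h1.trans (h2.trans hHceil)
    exact_mod_cast this
  -- the expansion data for this `β`, `ω`
  obtain ⟨ϑ, s, henergy, hpt⟩ := hE β hβ₁ ω hω
  -- notation
  set pin : Literature.MathematicalPhysics.QuantumLattice.ZdEdge 4 → Prop := fun e => e ∉ dirFreeEdges H with hpin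
  set Fb : Fin (dimE ρ) → Site 4 → ℝ := fun c x =>
    LatticeMaxwell.sCirc (LatticeMaxwell.glue (pin := pin) dirCorner (2 * H + 3) (ϑ c)
      (LatticeMaxwell.mean pin dirCorner (2 * H + 3) (ϑ c))) (x, i, j) with hFb
  set Ec : Fin (dimE ρ) → ℝ := fun c => LatticeMaxwell.formM pin dirCorner (2 * H + 3) (ϑ c) (s c) with hEc
  set xt : ℕ → Site 4 := fun t => boxCentre H + Pi.single 0 (t : ℤ) with hxt
  set Em : ℕ → ℝ := fun t => ∫ U, plaqCostAt ρ (xt t) i j U ∂(boxKernelG ρ β H ω) with hEm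
  set Vt : ℕ → ℝ := fun t => boxDirProjKernel H (xt t, i, j) (xt t, i, j) with hVt
  set Bt : ℕ → ℝ := fun t => ∑ c, Fb c (xt t) ^ 2 with hBt
  have hEc0 : ∀ c, 0 ≤ Ec c := fun c => by
    rw [hEc]; simp only [LatticeMaxwell.formM]; exact Finset.sum_nonneg fun p _ => sq_nonneg _
  have hnear : ∀ t : ℕ, t ≤ T → ∀ m : Fin 4, 8 * |xt t m - (H : ℤ)| ≤ (H : ℤ) := fun t ht m => near_centre_of_le h8T ht m
  -- the expansion at the points `xt t`, `t ≤ T`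
  have hexp_t : ∀ t : ℕ, t ≤ T → |β * Em t - (dimE ρ : ℝ) / 2 * Vt t - β * Bt t| ≤ β ^ (-θ) := fun t ht => hpt (xt t) (hnear t ht)
  -- interior bounds for each colour at the points `xt t`
  have hFb_d₁ : ∀ c x, Fb c x = d₁ (fun z (i : Fin 4) =>
      LatticeMaxwell.glue (pin := pin) dirCorner (2 * H + 3) (ϑ c) (LatticeMaxwell.mean pin dirCorner (2 * H + 3) (ϑ c)) (z, i))
        x i j := fun c x => by rw [hFb]; exact sCirc_eq_d₁ _ _
  have hsup : ∀ c (t : ℕ), t ≤ T → |Fb c (xt t)| ≤ C * Real.sqrt (Ec c) / (H : ℝ) ^ 2 := by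
    intro c t ht
    rw [hFb_d₁]
    exact (hI H hH8 (ϑ c) (s c) (xt t) (hnear t ht) i j).1
  have hgrad : ∀ c (t : ℕ), t + 1 ≤ T → |Fb c (xt (t + 1)) - Fb c (xt t)| ≤ C * Real.sqrt (Ec c) / (H : ℝ) ^ 3 := by
    intro c t ht
    have h := (hI H hH8 (ϑ c) (s c) (xt t) (hnear t (by omega)) i j).2 0
    have hx : xt (t + 1) = xt t + Pi.single 0 1 := by
      show boxCentre H + Pi.single 0 (((t + 1 : ℕ) : ℤ)) = boxCentre H + Pi.single 0 (t : ℤ) + Pi.single 0 1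
      rw [Nat.cast_succ, Pi.single_add, add_assoc]
    rw [hFb_d₁, hFb_d₁, hx]
    exact h
  -- per-step bound on the background term
  have hstep : ∀ t : ℕ, t + 1 ≤ T → |Bt (t + 1) - Bt t| ≤ 2 * C ^ 2 * (∑ c, Ec c) / (H : ℝ) ^ 5 := by
    intro t ht
    rw [hBt]
    simp only
    rw [← Finset.sum_sub_distrib, Finset.mul_sum, Finset.sum_div]
    refine (Finset.abs_sum_le_sum_abs _ _).trans (Finset.sum_le_sum fun c _ => ?_)
    have h1 := hsup c t (by omega)
    have h2 := hsup c (t + 1) ht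
    have h3 := hgrad c t ht
    have hs : Real.sqrt (Ec c) * Real.sqrt (Ec c) = Ec c := Real.mul_self_sqrt (hEc0 c)
    set r := Real.sqrt (Ec c) with hr
    refine (abs_sq_sub_sq_le h1 h2 h3).trans (le_of_eq ?_)
    rw [← hs]
    field_simp
  -- telescope
  have htel : |Bt T - Bt 0| ≤ (T : ℝ) * (2 * C ^ 2 * (∑ c, Ec c) / (H : ℝ) ^ 5) := by
    rw [← Finset.sum_range_sub Bt T]
    refine (Finset.abs_sum_le_sum_abs _ _).trans ?_
    calc ∑ i ∈ Finset.range T, |Bt (i + 1) - Bt i| ≤ ∑ _i ∈ Finset.range T, 2 * C ^ 2 * (∑ c, Ec c) / (H : ℝ) ^ 5 :=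
          Finset.sum_le_sum fun i hi => hstep i (by have := Finset.mem_range.1 hi; omega)
      _ = (T : ℝ) * (2 * C ^ 2 * (∑ c, Ec c) / (H : ℝ) ^ 5) := by rw [Finset.sum_const, Finset.card_range, nsmul_eq_mul]
  -- energy and geometry
  have hEsum : ∑ c, Ec c ≤ CE * (2 * (H : ℝ) + 3) ^ 4 * β ^ (2 * δ - 1) := henergy
  have hgeo : (2 * (H : ℝ) + 3) ^ 4 ≤ 625 * (H : ℝ) ^ 4 := two_mul_add_three_pow_four_le hH1'
  have hβpow : 0 < β ^ (2 * δ - 1) := Real.rpow_pos_of_pos hβ0 _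
  have hH0 : (H : ℝ) ≠ 0 := hHpos.ne'
  have hEsum' : ∑ c, Ec c ≤ |CE| * (2 * (H : ℝ) + 3) ^ 4 * β ^ (2 * δ - 1) :=
    hEsum.trans (mul_le_mul_of_nonneg_right (mul_le_mul_of_nonneg_right (le_abs_self CE) (by positivity)) hβpow.le)
  have hback : β * |Bt T - Bt 0| ≤ 1250 * |CE| * C ^ 2 * (β ^ (2 * δ) * T / H) := by
    have h2δ : β ^ (2 * δ) = β * β ^ (2 * δ - 1) := by
      rw [show 2 * δ = 1 + (2 * δ - 1) by ring, Real.rpow_add hβ0, Real.rpow_one]; ring_nf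
    rw [h2δ]
    have hT0 : (0 : ℝ) ≤ T := by positivity
    have hE' : ∑ c, Ec c ≤ |CE| * (625 * (H : ℝ) ^ 4) * β ^ (2 * δ - 1) :=
      hEsum'.trans (mul_le_mul_of_nonneg_right (mul_le_mul_of_nonneg_left hgeo (abs_nonneg CE)) hβpow.le)
    have hfrac : 2 * C ^ 2 * (∑ c, Ec c) / (H : ℝ) ^ 5 ≤ 1250 * |CE| * C ^ 2 * β ^ (2 * δ - 1) / (H : ℝ) := by
      rw [div_le_div_iff₀ (by positivity) hHpos]
      calc 2 * C ^ 2 * (∑ c, Ec c) * (H : ℝ) ≤ 2 * C ^ 2 * (|CE| * (625 * (H : ℝ) ^ 4) * β ^ (2 * δ - 1)) * (H : ℝ) := by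
            gcongr
        _ = 1250 * |CE| * C ^ 2 * β ^ (2 * δ - 1) * (H : ℝ) ^ 5 := by ring
    calc β * |Bt T - Bt 0| ≤ β * ((T : ℝ) * (2 * C ^ 2 * (∑ c, Ec c) / (H : ℝ) ^ 5)) :=
          mul_le_mul_of_nonneg_left htel hβ0.le
      _ ≤ β * ((T : ℝ) * (1250 * |CE| * C ^ 2 * β ^ (2 * δ - 1) / (H : ℝ))) := by gcongr
      _ = 1250 * |CE| * C ^ 2 * (β * β ^ (2 * δ - 1) * T / H) := by ring
  -- flatness of the Dirichlet variance
  have hflatT : |Vt T - Vt 0| ≤ KN / H := hN H hHH₀ (xt T) (xt 0) (hnear T le_rfl) (hnear 0 (Nat.zero_le _))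
  have hone : (1 : ℝ) ≤ β ^ (2 * δ) * T :=
    one_le_mul_of_one_le_of_one_le (Real.one_le_rpow hβ1 (by positivity : (0 : ℝ) ≤ 2 * δ)) hT1
  have hflat' : (dimE ρ : ℝ) / 2 * |Vt T - Vt 0| ≤ (dimE ρ : ℝ) / 2 * |KN| * (β ^ (2 * δ) * T / H) := by
    have h1 : KN / H ≤ |KN| / H := div_le_div_of_nonneg_right (le_abs_self KN) hHpos.le
    have h2 : |KN| / H ≤ |KN| * (β ^ (2 * δ) * T / H) := by
      rw [mul_div_assoc', div_le_div_iff_of_pos_right hHpos]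
      exact le_mul_of_one_le_right (abs_nonneg KN) hone
    have := hflatT.trans (h1.trans h2)
    rw [mul_assoc]
    exact mul_le_mul_of_nonneg_left this (by positivity)
  -- the two expansion errors
  have herr : 2 * β ^ (-θ) ≤ 4 * (β ^ (2 * δ) * T / H) := by
    have h1 : β ^ (-θ) * (H : ℝ) ≤ 2 := by
      calc β ^ (-θ) * (H : ℝ) ≤ β ^ (-θ) * (2 * β ^ θ) := mul_le_mul_of_nonneg_left hH2 (Real.rpow_nonneg hβ0.le _)
        _ = 2 * (β ^ (-θ) * β ^ θ) := by ring
        _ = 2 := by rw [← Real.rpow_add hβ0, neg_add_cancel, Real.rpow_zero, mul_one]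
    rw [mul_div_assoc', le_div_iff₀ hHpos]
    calc 2 * β ^ (-θ) * (H : ℝ) = 2 * (β ^ (-θ) * (H : ℝ)) := by ring
      _ ≤ 2 * 2 := by linarith
      _ ≤ 4 * (β ^ (2 * δ) * T) := by linarith
  -- assemble
  have hmain : β * |Em T - Em 0| ≤ (4 + (dimE ρ : ℝ) / 2 * |KN| + 1250 * |CE| * C ^ 2) * (β ^ (2 * δ) * T / H) := by
    have e1 := hexp_t T le_rfl
    have e0 := hexp_t 0 (Nat.zero_le _)
    have hsplit : β * (Em T - Em 0) = (β * Em T - (dimE ρ : ℝ) / 2 * Vt T - β * Bt T) - (β * Em 0 - (dimE ρ : ℝ) / 2 * Vt 0 - β * Bt 0) +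
        (dimE ρ : ℝ) / 2 * (Vt T - Vt 0) + β * (Bt T - Bt 0) := by ring
    have habs : β * |Em T - Em 0| = |β * (Em T - Em 0)| := by rw [abs_mul, abs_of_pos hβ0]
    rw [habs, hsplit]
    have hβB : |β * (Bt T - Bt 0)| = β * |Bt T - Bt 0| := by rw [abs_mul, abs_of_pos hβ0]
    have h32 : |(dimE ρ : ℝ) / 2 * (Vt T - Vt 0)| = (dimE ρ : ℝ) / 2 * |Vt T - Vt 0| := by rw [abs_mul, abs_of_nonneg (by positivity : (0 : ℝ) ≤ (dimE ρ : ℝ) / 2)]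
    calc |β * Em T - (dimE ρ : ℝ) / 2 * Vt T - β * Bt T - (β * Em 0 - (dimE ρ : ℝ) / 2 * Vt 0 - β * Bt 0) + (dimE ρ : ℝ) / 2 * (Vt T - Vt 0) + β * (Bt T - Bt 0)|
        ≤ |β * Em T - (dimE ρ : ℝ) / 2 * Vt T - β * Bt T - (β * Em 0 - (dimE ρ : ℝ) / 2 * Vt 0 - β * Bt 0) + (dimE ρ : ℝ) / 2 * (Vt T - Vt 0)| + |β * (Bt T - Bt 0)| :=
          abs_add_le _ _
      _ ≤ (|β * Em T - (dimE ρ : ℝ) / 2 * Vt T - β * Bt T - (β * Em 0 - (dimE ρ : ℝ) / 2 * Vt 0 - β * Bt 0)| + |(dimE ρ : ℝ) / 2 * (Vt T - Vt 0)|) + |β * (Bt T - Bt 0)| := by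
          gcongr; exact abs_add_le _ _
      _ ≤ ((|β * Em T - (dimE ρ : ℝ) / 2 * Vt T - β * Bt T| + |β * Em 0 - (dimE ρ : ℝ) / 2 * Vt 0 - β * Bt 0|) + |(dimE ρ : ℝ) / 2 * (Vt T - Vt 0)|) + |β * (Bt T - Bt 0)| := by
          gcongr; exact abs_sub _ _
      _ ≤ ((β ^ (-θ) + β ^ (-θ)) + (dimE ρ : ℝ) / 2 * |KN| * (β ^ (2 * δ) * T / H)) + 1250 * |CE| * C ^ 2 * (β ^ (2 * δ) * T / H) := by
          rw [hβB, h32]; gcongr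
      _ ≤ (4 + (dimE ρ : ℝ) / 2 * |KN| + 1250 * |CE| * C ^ 2) * (β ^ (2 * δ) * T / H) := by linarith [herr, hflat', hback]
  -- conclude: divide by β
  have hgoal : |Em T - Em 0| ≤ (4 + (dimE ρ : ℝ) / 2 * |KN| + 1250 * |CE| * C ^ 2) * β ^ (2 * δ - 1) * (T : ℝ) / (H : ℝ) := by
    have h2δ : β ^ (2 * δ) = β * β ^ (2 * δ - 1) := by
      rw [show 2 * δ = 1 + (2 * δ - 1) by ring, Real.rpow_add hβ0, Real.rpow_one]; ring_nf
    rw [h2δ] at hmain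
    have : β * |Em T - Em 0| ≤ β * ((4 + (dimE ρ : ℝ) / 2 * |KN| + 1250 * |CE| * C ^ 2) * β ^ (2 * δ - 1) * (T : ℝ) / (H : ℝ)) := by
      calc β * |Em T - Em 0| ≤ _ := hmain
        _ = β * ((4 + (dimE ρ : ℝ) / 2 * |KN| + 1250 * |CE| * C ^ 2) * β ^ (2 * δ - 1) * (T : ℝ) / (H : ℝ)) := by ring
    exact le_of_mul_le_mul_left this hβ0
  -- match the statement of `GoodBoundaryMeanSmooth`
  have hx0 : xt 0 = boxCentre H := by rw [hxt]; simp
  have hEm0 : Em 0 = ∫ U, plaqCostAt ρ (boxCentre H) i j U ∂(boxKernelG ρ β H ω) := by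
    rw [hEm]; simp only [hx0]
  have hEmT : Em T = ∫ U, plaqCostAt ρ (boxCentre H + Pi.single 0 (T : ℤ)) i j U ∂(boxKernelG ρ β H ω) := by
    rw [hEm]
  rw [hEm0, hEmT] at hgoal
  simpa only [hHdef, hTdef, hδ] using hgoal

end MeanSmooth

/-! ## The inputs in every plane, and the deliverable for every compact simple `G` -/

/-- **The flat Dirichlet variance in plane `(i,j)`** (rate `K/H`, integer near-centre form): from the all-planes `abs_boxDirProjKernel_diag_sub_le`
(in fact `O(H⁻⁴)`), as `dirKernelDiagFlat` does for `(1,2)`. -/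
theorem dirKernelDiagFlat_plane {i j : Fin 4} (hij : i < j) : ∃ K : ℝ, ∃ H₀ : ℕ, ∀ H : ℕ, H₀ ≤ H → ∀ x x' : Site 4,
    (∀ m : Fin 4, 8 * |x m - (H : ℤ)| ≤ (H : ℤ)) → (∀ m : Fin 4, 8 * |x' m - (H : ℤ)| ≤ (H : ℤ)) →
      |boxDirProjKernel H (x, i, j) (x, i, j) - boxDirProjKernel H (x', i, j) (x', i, j)| ≤ K / H := by
  obtain ⟨K, hK0, hK⟩ := abs_boxDirProjKernel_diag_sub_le
  refine ⟨2 * K, 32, fun H hH x x' hx hx' => ?_⟩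
  have hHr : (32 : ℝ) ≤ H := by exact_mod_cast hH
  have hH1 : (1 : ℝ) ≤ H := by linarith
  have hH0 : (0 : ℝ) < H := by linarith
  have h := hK H hHr x x' i j hij (norm_sub_boxCentre_le_of_int hx) (norm_sub_boxCentre_le_of_int hx')
  refine h.trans ?_
  rw [div_le_div_iff₀ (pow_pos hH0 4) hH0]
  have h4 : (H : ℝ) ≤ (H : ℝ) ^ 4 := by
    calc (H : ℝ) = (H : ℝ) ^ 1 := (pow_one _).symm
      _ ≤ (H : ℝ) ^ 4 := pow_le_pow_right₀ hH1 (by norm_num)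
  have hK2 : 0 ≤ 2 * K := by positivity
  nlinarith

/-- **The plane-`(i,j)` one-scale mean expansion with error `β^{−θ}`** for every compact simple `G`, `0 < θ ≤ 1/200`: from the sharp all-planes
expansion `kernelMeanSharpG` (`β^{−1/4} ≤ β^{−θ}` for `β ≥ 1`). -/
theorem kernelMeanExpansion_plane_of_sharp
    (G : Type) [Group G] [TopologicalSpace G] [IsTopologicalGroup G] [CompactSpace G] [MeasurableSpace G] [BorelSpace G]
    (hG : IsCompactSimpleLieGroup G) (r : LatticeRep G) {θ : ℝ} (hθ : 0 < θ) (hθ2 : θ ≤ 1 / 200) (i j : Fin 4) (hij : i < j) :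
    ∃ CE : ℝ, ∃ β₀ : ℝ, ∀ β : ℝ, β₀ ≤ β → ∀ ω : LGConfig 4 G, CrudeGoodG r.ρ β (θ / 5) ⌈β ^ θ⌉₊ ω →
      ∃ ϑ : Fin (dimE r.ρ) → (Literature.MathematicalPhysics.QuantumLattice.ZdEdge 4 → ℝ), ∃ s : Fin (dimE r.ρ) → (DirFree ⌈β ^ θ⌉₊ → ℝ),
        (∑ c, LatticeMaxwell.formM (fun e => e ∉ dirFreeEdges ⌈β ^ θ⌉₊) dirCorner (2 * ⌈β ^ θ⌉₊ + 3) (ϑ c) (s c) ≤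
            CE * (2 * (⌈β ^ θ⌉₊ : ℝ) + 3) ^ 4 * β ^ (2 * (θ / 5) - 1)) ∧
        ∀ x : Site 4, (∀ m : Fin 4, 8 * |x m - (⌈β ^ θ⌉₊ : ℤ)| ≤ (⌈β ^ θ⌉₊ : ℤ)) →
          |β * (∫ U, plaqCostAt r.ρ x i j U ∂(boxKernelG r.ρ β ⌈β ^ θ⌉₊ ω)) -
              (dimE r.ρ : ℝ) / 2 * boxDirProjKernel ⌈β ^ θ⌉₊ (x, i, j) (x, i, j) -
              β * ∑ c, LatticeMaxwell.sCirc (LatticeMaxwell.glue (pin := fun e => e ∉ dirFreeEdges ⌈β ^ θ⌉₊) dirCorner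
                (2 * ⌈β ^ θ⌉₊ + 3) (ϑ c) (LatticeMaxwell.mean (fun e => e ∉ dirFreeEdges ⌈β ^ θ⌉₊) dirCorner (2 * ⌈β ^ θ⌉₊ + 3)
                (ϑ c))) (x, i, j) ^ 2| ≤ β ^ (-θ) := by
  obtain ⟨CE, β₀, h⟩ := kernelMeanSharpG G hG r hθ hθ2
  refine ⟨CE, max β₀ 1, fun β hβ ω hω => ?_⟩
  have hb₀ : β₀ ≤ β := (le_max_left _ _).trans hβ
  have hβ1 : (1 : ℝ) ≤ β := (le_max_right _ _).trans hβ
  obtain ⟨ϑ, s, hE, hpt⟩ := h β hb₀ ω hω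
  refine ⟨ϑ, s, hE, fun x hx => ?_⟩
  have hmono : β ^ (-(1 / 4 : ℝ)) ≤ β ^ (-θ) := Real.rpow_le_rpow_of_exponent_le hβ1 (by linarith)
  exact (hpt x hx i j hij).trans hmono

/-- **L1b-G for ALL SIX PLANES, every compact simple `G`**: for `r : LatticeRep G`, exponents `0 < A < θ ≤ 1/200` and every plane `i < j` there
are `K, β₀` such that for `β ≥ β₀` and every crude-good datum `ω` (scale `β^{2(θ/5)−1}`, box `H = ⌈β^θ⌉`),
`|E_ω c_{(c_H+⌈β^A⌉e₀;i,j)} − E_ω c_{(c_H;i,j)}| ≤ K·β^{2(θ/5)−1}·⌈β^A⌉/⌈β^θ⌉` — deep conditional means are position-smooth along `e₀` in every plane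
(the `(1,2)`, `A = θ/20` instance is the tree's `goodBoundaryMeanSmoothG_allGroups`). -/
theorem goodBoundaryMeanSmoothG_allPlanes
    (G : Type) [Group G] [TopologicalSpace G] [IsTopologicalGroup G] [CompactSpace G] [MeasurableSpace G] [BorelSpace G]
    (hG : IsCompactSimpleLieGroup G) (r : LatticeRep G) {A θ : ℝ} (hA : 0 < A) (hAθ : A < θ) (hθ2 : θ ≤ 1 / 200)
    (i j : Fin 4) (hij : i < j) :
    ∃ K : ℝ, ∃ β₀ : ℝ, ∀ β : ℝ, β₀ ≤ β → ∀ ω : LGConfig 4 G, CrudeGoodG r.ρ β (θ / 5) ⌈β ^ θ⌉₊ ω →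
      |(∫ U, plaqCostAt r.ρ (boxCentre ⌈β ^ θ⌉₊ + Pi.single 0 (⌈β ^ A⌉₊ : ℤ)) i j U ∂(boxKernelG r.ρ β ⌈β ^ θ⌉₊ ω)) -
          (∫ U, plaqCostAt r.ρ (boxCentre ⌈β ^ θ⌉₊) i j U ∂(boxKernelG r.ρ β ⌈β ^ θ⌉₊ ω))|
        ≤ K * β ^ (2 * (θ / 5) - 1) * (⌈β ^ A⌉₊ : ℝ) / (⌈β ^ θ⌉₊ : ℝ) :=
  goodBoundaryMeanSmoothG_plane_at r.ρ (hA.trans hAθ) hA hAθ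
    (kernelMeanExpansion_plane_of_sharp G hG r (hA.trans hAθ) hθ2 i j hij) (dirKernelDiagFlat_plane hij)

end Summit.QuantumFields.YangMills.Theorems.ColdBoxAllGroups

end
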